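/-
HONEST FRAMING: certified error envelopes and provably optimal rounding/accumulation schemes for
low-precision formats under stated cost models; every table by two implementations; no hardware
or vendor claims.
-/
import Summits.Ventures.CertifiedArithmetic.LowPrec.OptDemotionRoutingShift
import Summits.Ventures.CertifiedArithmetic.LowPrec.OptDemotionRoutingValue

/-!
# The demotion law (Theorem T8), part 10c: TWO-FAMILY COORDINATES and opt's all-`q` e-side theorem R31

opt gen 15 (gen15/README §5, OPTIMA.md T8 (R31)).  The TWO-FAMILY COORDINATES of a tree are the
routing values of the two-bit configurations `{0, -i}` (`x_i = BR_t(1 + 2^-i)`, `x_0 = BR_t(1)`);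
by parts 8a′/8c (`treeBR_singleton`, `treeBR_pair`) they are, up to the factor `u = 2^-q`, the
EXCESSES of opt's one-family demotion polynomial: `u · BR_t{0, -i} = E_t(2^-i)`,
`E_t(ρ) := treeQf u t ρ - 1 - ρ`, and `u · BR_t{0} = μ_t := M_t - 1`, whose node recursion is the
explicit four-option maximum `treeQf_excess_node` (part 8c).  In these coordinates monotonicity (M)
is `μ_t ≤ E_t(ρ)` (`treeM_add_le_treeQf`) and midpoint convexity (MC, part 8h) transports to
`2 E_t(2^e) ≤ μ_t + E_t(2^(e+1))` (`two_excess_le`).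

**R31 (THEOREM, every tree, every `q ≥ 3`, every `2 ≤ j ≤ q - 1`).**
`E_t(2·2^-j) ≤ (1 - u) E_t(2^-j) + (1 + u) 2^-j E_t(2^(j-q))` (`excess_twoFam_le`), i.e.
`2 BR_t{-1, -j} ≤ (1 - u) BR_t{0, -j} + (1 + u) BR_t{-j, -q}` (`treeBR_twoFam_le`), i.e. in the
budget units of parts 8l/9d the `E`-ROW `E(β = ½, B = 2^-j, ρ = u)` of opt's single-tree split of
the two-tree inequality: `2 BR_t(e) ≤ (1 - u) BR_t(e + β) + (1 + u) BR_t(e - β + ½)`,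
`β = 2^(q-2)`, `e = β + 2^i`, `0 ≤ i ≤ q - 3` (`treeBRv_eRow_halfBit`) — the first e-side target
proved for ALL precisions at once.  The proof is opt's: induction on the tree; at a node, by the
option realising the maximum on the left, an explicit nonnegative combination of (M), (MC) and the
induction hypothesis (the 4-branch Farkas certificate of gen15 §5, multipliers `μ = u x/(1-x)`,
`λ = (1+u) x - μ`, `x = 2^-j`, cleared of denominators) — `twoFam_node_step`, pure arithmetic.
Corollaries: by homogeneity (part 8j) and (M) the single-bit `E`-rows at EVERY level `β = 2^k`
(`treeBRv_eRow_singleBit`), so that under R29 (part 10b, `B < β`) the e-side targets left at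
`ρ = u` are the offsets `B` with at least two bits.
-/

namespace Summit.Ventures.CertifiedArithmetic.LowPrec.Opt

open Literature.ComputerArithmetic.JeannerodRump2018
open Literature.ComputerArithmetic.JeannerodRump2018.SumTree

/-! ## The node step: opt's four-branch certificate (pure arithmetic) -/

/-- THE NODE STEP OF R31 in scaled two-family coordinates.  For a node with children `a, b` write
`m = μ`, `P = E(2x)`, `X = E(x)`, `Y = E(y)`, `Z = E(y/2)` for each child (`x = 2^-j`,
`y = 2^j u`, `u = x y`); the node's `E(2x)`, `E(x)`, `E(y)` are `u +` the four-option maxima of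
`treeQf_excess_node`.  Given (M) (`m ≤ X`, `m ≤ Y`), (MC) (`2 Z ≤ m + Y`) and the induction
hypothesis `P ≤ (1-u) X + (1+u) x Y` for both children, the node satisfies the same inequality
(`0 < x ≤ ¼`, `0 < y ≤ ½`).  Branches `P_a + u m_b`, `P_b + u m_a`: the hypothesis and the sign of
the node constant `u - x - u x < 0`; branches `m_a + 2x Z_b`, `m_b + 2x Z_a`: opt's identity
`LHS - RHS = α (m_a - X_a) + x (2 Z_b - m_b - Y_b) + δ (m_b - Y_b) + u (u - x - u x)` with
`α = u (1 - μ)`, `δ = μ - u x`, `μ = u x / (1 - x)` (here multiplied through by `1 - x`). -/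
theorem twoFam_node_step {x y u ma Pa Xa Ya Za mb Pb Xb Yb Zb : ℚ} (hu : u = x * y)
    (hx0 : 0 < x) (hx : x ≤ 1 / 4) (hy0 : 0 < y) (hy : y ≤ 1 / 2)
    (hma : 0 ≤ ma) (hmb : 0 ≤ mb)
    (hMa : ma ≤ Xa) (hMa' : ma ≤ Ya) (hMb : mb ≤ Xb) (hMb' : mb ≤ Yb)
    (hCa : 2 * Za ≤ ma + Ya) (hCb : 2 * Zb ≤ mb + Yb)
    (iha : Pa ≤ (1 - u) * Xa + (1 + u) * x * Ya) (ihb : Pb ≤ (1 - u) * Xb + (1 + u) * x * Yb) :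
    u + max (max (Pa + u * mb) (Pb + u * ma)) (max (ma + 2 * x * Zb) (mb + 2 * x * Za)) ≤
      (1 - u) * (u + max (max (Xa + u * mb) (Xb + u * ma)) (max (ma + x * Yb) (mb + x * Ya))) +
      (1 + u) * x * (u + max (max (Ya + u * mb) (Yb + u * ma)) (max (ma + y * Xb) (mb + y * Xa))) := by
  subst hu
  set MX := max (max (Xa + x * y * mb) (Xb + x * y * ma)) (max (ma + x * Yb) (mb + x * Ya)) with hMX
  set MY := max (max (Ya + x * y * mb) (Yb + x * y * ma)) (max (ma + y * Xb) (mb + y * Xa)) with hMY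
  set R := (1 - x * y) * (x * y + MX) + (1 + x * y) * x * (x * y + MY) with hR
  -- options dominated by the maxima
  have hX1 : Xa + x * y * mb ≤ MX := le_max_of_le_left (le_max_left _ _)
  have hX2 : Xb + x * y * ma ≤ MX := le_max_of_le_left (le_max_right _ _)
  have hX3 : ma + x * Yb ≤ MX := le_max_of_le_right (le_max_left _ _)
  have hX4 : mb + x * Ya ≤ MX := le_max_of_le_right (le_max_right _ _)
  have hY1 : Ya + x * y * mb ≤ MY := le_max_of_le_left (le_max_left _ _)
  have hY2 : Yb + x * y * ma ≤ MY := le_max_of_le_left (le_max_right _ _)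
  have hY3 : ma + y * Xb ≤ MY := le_max_of_le_right (le_max_left _ _)
  have hY4 : mb + y * Xa ≤ MY := le_max_of_le_right (le_max_right _ _)
  -- signs of the multipliers
  have hxy : 0 ≤ x * y := by positivity
  have h1u : 0 ≤ 1 - x * y := by nlinarith
  have h1x : 0 < 1 - x := by linarith
  have hin : 0 ≤ 1 - x - x * y * x := by nlinarith
  have hlam : 0 ≤ x * (1 - x) * (1 + x * y) - x * y * x := by nlinarith
  have hα : 0 ≤ x * y * (1 - x) - x * y * (x * y) * x := by nlinarith
  have hκ : 0 ≤ x + x * y * x - x * y := by nlinarith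
  have hc0 : 0 ≤ (1 + x * y) * x := by positivity
  have huc : 0 ≤ x * y * x := by positivity
  have hk0 : 0 ≤ x * y * (x + x * y * x - x * y) := mul_nonneg hxy hκ
  -- branch P_a + u m_b
  have b1 : Pa + x * y * mb ≤ R - x * y := by
    have p1 : (1 - x * y) * (Xa + x * y * mb) ≤ (1 - x * y) * MX := mul_le_mul_of_nonneg_left hX1 h1u
    have p2 : (1 + x * y) * x * (Ya + x * y * mb) ≤ (1 + x * y) * x * MY :=
      mul_le_mul_of_nonneg_left hY1 hc0
    have p3 : 0 ≤ x * y * mb * (x + x * y * x - x * y) := mul_nonneg (mul_nonneg hxy hmb) hκ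
    rw [hR]; linarith
  -- branch P_b + u m_a
  have b2 : Pb + x * y * ma ≤ R - x * y := by
    have p1 : (1 - x * y) * (Xb + x * y * ma) ≤ (1 - x * y) * MX := mul_le_mul_of_nonneg_left hX2 h1u
    have p2 : (1 + x * y) * x * (Yb + x * y * ma) ≤ (1 + x * y) * x * MY :=
      mul_le_mul_of_nonneg_left hY2 hc0
    have p3 : 0 ≤ x * y * ma * (x + x * y * x - x * y) := mul_nonneg (mul_nonneg hxy hma) hκ
    rw [hR]; linarith
  -- branch m_a + 2x Z_b : opt's certificate, multiplied through by (1 - x)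
  have b3 : ma + 2 * x * Zb ≤ R - x * y := by
    have q1 : (1 - x) * (1 - x * y) * (ma + x * Yb) ≤ (1 - x) * (1 - x * y) * MX :=
      mul_le_mul_of_nonneg_left hX3 (mul_nonneg h1x.le h1u)
    have q2 : (x * (1 - x) * (1 + x * y) - x * y * x) * (mb + y * Xa) ≤
        (x * (1 - x) * (1 + x * y) - x * y * x) * MY := mul_le_mul_of_nonneg_left hY4 hlam
    have q3 : x * y * x * (Yb + x * y * ma) ≤ x * y * x * MY := mul_le_mul_of_nonneg_left hY2 huc
    have q4 : 0 ≤ (x * y * (1 - x) - x * y * (x * y) * x) * (Xa - ma) := mul_nonneg hα (by linarith)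
    have q5 : 0 ≤ x * (1 - x) * (mb + Yb - 2 * Zb) := mul_nonneg (by positivity) (by linarith)
    have q6 : 0 ≤ x * y * x * x * (Yb - mb) := mul_nonneg (by positivity) (by linarith)
    have q7 : 0 ≤ (1 - x) * (x * y) * (x + x * y * x - x * y) := mul_nonneg (mul_nonneg h1x.le hxy) hκ
    have key : (1 - x) * (ma + 2 * x * Zb) ≤ (1 - x) * (R - x * y) := by rw [hR]; linarith
    exact le_of_mul_le_mul_left key h1x
  -- branch m_b + 2x Z_a (a ↔ b)
  have b4 : mb + 2 * x * Za ≤ R - x * y := by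
    have q1 : (1 - x) * (1 - x * y) * (mb + x * Ya) ≤ (1 - x) * (1 - x * y) * MX :=
      mul_le_mul_of_nonneg_left hX4 (mul_nonneg h1x.le h1u)
    have q2 : (x * (1 - x) * (1 + x * y) - x * y * x) * (ma + y * Xb) ≤
        (x * (1 - x) * (1 + x * y) - x * y * x) * MY := mul_le_mul_of_nonneg_left hY3 hlam
    have q3 : x * y * x * (Ya + x * y * mb) ≤ x * y * x * MY := mul_le_mul_of_nonneg_left hY1 huc
    have q4 : 0 ≤ (x * y * (1 - x) - x * y * (x * y) * x) * (Xb - mb) := mul_nonneg hα (by linarith)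
    have q5 : 0 ≤ x * (1 - x) * (ma + Ya - 2 * Za) := mul_nonneg (by positivity) (by linarith)
    have q6 : 0 ≤ x * y * x * x * (Ya - ma) := mul_nonneg (by positivity) (by linarith)
    have q7 : 0 ≤ (1 - x) * (x * y) * (x + x * y * x - x * y) := mul_nonneg (mul_nonneg h1x.le hxy) hκ
    have key : (1 - x) * (mb + 2 * x * Za) ≤ (1 - x) * (R - x * y) := by rw [hR]; linarith
    exact le_of_mul_le_mul_left key h1x
  have := max_le (max_le b1 b2) (max_le b3 b4)
  linarith

/-! ## (M) and (MC) in two-family coordinates -/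

section TwoFam

variable {q : ℕ}

/-- `u = 2^-q`. -/
theorem unitRoundoff_eq_zpow (q : ℕ) : unitRoundoff q = (2 : ℚ) ^ (-(q : ℤ)) := by
  rw [unitRoundoff, one_div, ← zpow_natCast, ← zpow_neg]

/-- (M) in two-family coordinates: `μ_t ≤ E_t(ρ)` for `ρ > 0` (part 8c `treeM_add_le_treeQf`). -/
theorem treeM_sub_one_le_excess (u : ℚ) (t : SumTree) {ρ : ℚ} (hρ : 0 < ρ) :
    treeM u t - 1 ≤ treeQf u t ρ - 1 - ρ := by
  linarith [treeM_add_le_treeQf u t hρ]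

/-- The two-bit configuration `{0, e}` is routable for `1 - q ≤ e ≤ 0`... here `e < 0`. -/
theorem routable_zero_pair {e : ℤ} (he : e < 0) (heq : 1 - (q : ℤ) ≤ e) :
    Routable q ({0, e} : Finset ℤ) := by
  intro a ha b hb
  simp only [Finset.mem_insert, Finset.mem_singleton] at ha hb
  rcases ha with rfl | rfl <;> rcases hb with rfl | rfl <;> omega

/-- `u · BR_t{0, e} = E_t(2^e)` for `-q < e < 0` (part 8c `treeBR_pair` at `e₀ = 0`). -/
theorem mul_treeBR_zero_pair (hq : 1 ≤ q) (t : SumTree) {e : ℤ} (he : e < 0) (heq : -(q : ℤ) < e) :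
    unitRoundoff q * treeBR q t {0, e} =
      treeQf (unitRoundoff q) t ((2 : ℚ) ^ e) - 1 - (2 : ℚ) ^ e := by
  have h := treeBR_pair hq t (e₀ := 0) (e := e) he (by omega)
  simpa using h

/-- `u · BR_t{0} = μ_t` (part 8a′ `treeBR_singleton` at `e = 0`). -/
theorem mul_treeBR_zero (hq : 1 ≤ q) (t : SumTree) :
    unitRoundoff q * treeBR q t {0} = treeM (unitRoundoff q) t - 1 := by
  have h := treeBR_singleton hq t 0
  simpa using h

/-- **(MC) IN TWO-FAMILY COORDINATES**: `2 E_t(2^e) ≤ μ_t + E_t(2^(e+1))` for `1 - q ≤ e ≤ -2`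
(part 8h `treeBR_midconvex` at `{0, e}` in the direction of the bit `e`, transported by
`treeBR_pair` / `treeBR_singleton`). -/
theorem two_excess_le (hq : 1 ≤ q) (t : SumTree) {e : ℤ} (he2 : e ≤ -2) (heq : 1 - (q : ℤ) ≤ e) :
    2 * (treeQf (unitRoundoff q) t ((2 : ℚ) ^ e) - 1 - (2 : ℚ) ^ e) ≤
      (treeM (unitRoundoff q) t - 1) +
        (treeQf (unitRoundoff q) t ((2 : ℚ) ^ (e + 1)) - 1 - (2 : ℚ) ^ (e + 1)) := by
  classical
  have hS : Routable q ({0, e} : Finset ℤ) := routable_zero_pair (by omega) heq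
  have hS' : Routable q ({0, e + 1} : Finset ℤ) := routable_zero_pair (by omega) (by omega)
  have hrun : ∀ i : ℕ, i ≤ 0 → e + (i : ℤ) ∈ ({0, e} : Finset ℤ) := by
    intro i hi
    have : i = 0 := by omega
    subst this; simp
  have hβ' : e + (((0 : ℕ) : ℤ) + 1) ∉ ({0, e} : Finset ℤ) := by
    simp only [Nat.cast_zero, zero_add, Finset.mem_insert, Finset.mem_singleton]; omega
  have e1 : insert (e + (((0 : ℕ) : ℤ) + 1))
      (({0, e} : Finset ℤ) \ (Finset.range (0 + 1)).image (fun i : ℕ => e + (i : ℤ))) =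
        ({0, e + 1} : Finset ℤ) := by
    ext z
    simp only [Nat.cast_zero, zero_add, Finset.range_one, Finset.image_singleton, add_zero,
      Finset.mem_insert, Finset.mem_sdiff, Finset.mem_singleton]
    omega
  have e2 : ({0, e} : Finset ℤ).erase e = {0} := by
    ext z
    simp only [Finset.mem_erase, Finset.mem_insert, Finset.mem_singleton]
    omega
  have hmc := treeBR_midconvex (q := q) t hS (β := e) (j := 0) hrun hβ' (by rw [e1]; exact hS')
  rw [e1, e2] at hmc
  have hu : 0 ≤ unitRoundoff q := unitRoundoff_nonneg q
  have hp := mul_treeBR_zero_pair hq t (e := e) (by omega) (by omega)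
  have hp' := mul_treeBR_zero_pair hq t (e := e + 1) (by omega) (by omega)
  have hs := mul_treeBR_zero hq t
  have := mul_le_mul_of_nonneg_left hmc hu
  linarith

/-! ## R31 -/

/-- **R31 IN POLYNOMIAL FORM (opt gen 15 §5; every tree, every `q ≥ 3`, every `2 ≤ j ≤ q - 1`).**
With `u = 2^-q`, `x = 2^-j`, `y = 2^(j-q)` and `E_t(ρ) = treeQf u t ρ - 1 - ρ`:
`E_t(2x) ≤ (1 - u) E_t(x) + (1 + u) x E_t(y)`. -/
theorem excess_twoFam_le (hq : 3 ≤ q) {j : ℕ} (hj : 2 ≤ j) (hjq : j + 1 ≤ q) : ∀ t : SumTree,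
    treeQf (unitRoundoff q) t (2 * (2 : ℚ) ^ (-(j : ℤ))) - 1 - 2 * (2 : ℚ) ^ (-(j : ℤ)) ≤
      (1 - unitRoundoff q) *
          (treeQf (unitRoundoff q) t ((2 : ℚ) ^ (-(j : ℤ))) - 1 - (2 : ℚ) ^ (-(j : ℤ))) +
        (1 + unitRoundoff q) * (2 : ℚ) ^ (-(j : ℤ)) *
          (treeQf (unitRoundoff q) t ((2 : ℚ) ^ ((j : ℤ) - q)) - 1 - (2 : ℚ) ^ ((j : ℤ) - q)) := by
  have hq1 : 1 ≤ q := by omega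
  set u := unitRoundoff q with hudef
  set x : ℚ := (2 : ℚ) ^ (-(j : ℤ)) with hxdef
  set y : ℚ := (2 : ℚ) ^ ((j : ℤ) - q) with hydef
  have hx0 : 0 < x := zpow_pos (by norm_num) _
  have hy0 : 0 < y := zpow_pos (by norm_num) _
  have hx4 : x ≤ 1 / 4 := by
    have : x ≤ (2 : ℚ) ^ (-2 : ℤ) := zpow_le_zpow_right₀ (by norm_num) (by omega)
    have e4 : (2 : ℚ) ^ (-2 : ℤ) = 1 / 4 := by norm_num
    rwa [e4] at this
  have hy2 : y ≤ 1 / 2 := by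
    have : y ≤ (2 : ℚ) ^ (-1 : ℤ) := zpow_le_zpow_right₀ (by norm_num) (by omega)
    have e2 : (2 : ℚ) ^ (-1 : ℤ) = 1 / 2 := by norm_num
    rwa [e2] at this
  have huz : u = (2 : ℚ) ^ (-(q : ℤ)) := unitRoundoff_eq_zpow q
  have hu : u = x * y := by
    rw [huz, hxdef, hydef, ← zpow_add₀ (by norm_num : (2 : ℚ) ≠ 0)]; congr 1; ring
  have hu0 : 0 ≤ u := unitRoundoff_nonneg q
  have hdiv1 : u / (2 * x) = y / 2 := by rw [hu]; field_simp
  have hdiv2 : u / x = y := by rw [hu]; field_simp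
  have hdiv3 : u / y = x := by rw [hu]; field_simp
  have hy' : (2 : ℚ) ^ ((j : ℤ) - q - 1) = y / 2 := by
    rw [hydef, zpow_sub_one₀ (by norm_num : (2 : ℚ) ≠ 0)]; ring
  have hy'' : (2 : ℚ) ^ ((j : ℤ) - q - 1 + 1) = y := by rw [hydef]; congr 1; ring
  -- (MC) for a child: 2 E(y/2) ≤ μ + E(y)
  have MC : ∀ c : SumTree, 2 * (treeQf u c (y / 2) - 1 - y / 2) ≤
      (treeM u c - 1) + (treeQf u c y - 1 - y) := by
    intro c
    have h := two_excess_le hq1 c (e := (j : ℤ) - q - 1) (by omega) (by omega)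
    rw [hy', hy''] at h
    exact h
  intro t
  induction t with
  | leaf z =>
      simp only [treeQf_leaf]
      nlinarith [hu0, hx0]
  | node a b iha ihb =>
      rw [treeQf_excess_node u a b (by positivity : 2 * x ≠ 0), treeQf_excess_node u a b hx0.ne',
        treeQf_excess_node u a b hy0.ne', hdiv1, hdiv2, hdiv3]
      exact twoFam_node_step hu hx0 hx4 hy0 hy2
        (by linarith [one_le_treeM hu0 a]) (by linarith [one_le_treeM hu0 b])
        (treeM_sub_one_le_excess u a hx0) (treeM_sub_one_le_excess u a hy0)
        (treeM_sub_one_le_excess u b hx0) (treeM_sub_one_le_excess u b hy0)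
        (MC a) (MC b) iha ihb

/-- **R31 IN ROUTING VALUES** (two-family coordinates `x_i = BR_t{0, -i}`): for `q ≥ 3`,
`2 ≤ j ≤ q - 1` and every tree, `2 · BR_t{-1, -j} ≤ (1 - u) · BR_t{0, -j} + (1 + u) · BR_t{-j, -q}`
— opt's `x_{j-1} ≤ (1-u) x_j + (1+u) 2^-j x_{q-j}`. -/
theorem treeBR_twoFam_le (hq : 3 ≤ q) {j : ℕ} (hj : 2 ≤ j) (hjq : j + 1 ≤ q) (t : SumTree) :
    2 * treeBR q t {-1, -(j : ℤ)} ≤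
      (1 - unitRoundoff q) * treeBR q t {0, -(j : ℤ)} +
        (1 + unitRoundoff q) * treeBR q t {-(j : ℤ), -(q : ℤ)} := by
  have hq1 : 1 ≤ q := by omega
  have h := excess_twoFam_le hq hj hjq t
  have hu : 0 < unitRoundoff q := by unfold unitRoundoff; positivity
  -- the three configurations in polynomial form
  have h0 := mul_treeBR_zero_pair hq1 t (e := -(j : ℤ)) (by omega) (by omega)
  have h1 := treeBR_pair hq1 t (e₀ := -1) (e := -(j : ℤ)) (by omega) (by omega)
  have h2 := treeBR_pair hq1 t (e₀ := -(j : ℤ)) (e := -(q : ℤ)) (by omega) (by omega)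
  have e1 : (2 : ℚ) ^ (-(j : ℤ)) / (2 : ℚ) ^ (-1 : ℤ) = 2 * (2 : ℚ) ^ (-(j : ℤ)) := by
    rw [zpow_neg_one]; field_simp
  have e2 : (2 : ℚ) ^ (-(q : ℤ)) / (2 : ℚ) ^ (-(j : ℤ)) = (2 : ℚ) ^ ((j : ℤ) - q) := by
    rw [← zpow_sub₀ (by norm_num : (2 : ℚ) ≠ 0)]; congr 1; ring
  have e3 : (2 : ℚ) ^ (-1 : ℤ) = 1 / 2 := by norm_num
  rw [e1, e3] at h1
  rw [e2] at h2
  -- assemble: u · (2 BR{-1,-j}) = E(2x) ≤ (1-u) E(x) + (1+u) x E(y) = u · RHS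
  have key : unitRoundoff q * (2 * treeBR q t {-1, -(j : ℤ)}) ≤
      unitRoundoff q * ((1 - unitRoundoff q) * treeBR q t {0, -(j : ℤ)} +
        (1 + unitRoundoff q) * treeBR q t {-(j : ℤ), -(q : ℤ)}) := by
    have eL : unitRoundoff q * (2 * treeBR q t {-1, -(j : ℤ)}) =
        2 * (unitRoundoff q * treeBR q t {-1, -(j : ℤ)}) := by ring
    have eR : unitRoundoff q * ((1 - unitRoundoff q) * treeBR q t {0, -(j : ℤ)} +
        (1 + unitRoundoff q) * treeBR q t {-(j : ℤ), -(q : ℤ)}) =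
        (1 - unitRoundoff q) * (unitRoundoff q * treeBR q t {0, -(j : ℤ)}) +
          (1 + unitRoundoff q) * (unitRoundoff q * treeBR q t {-(j : ℤ), -(q : ℤ)}) := by ring
    rw [eL, eR, h0, h1, h2]
    linarith [h]
  exact le_of_mul_le_mul_left key hu

/-! ## The single-bit `E`-rows of the split, at every level, for every tree -/

/-- `val {a, b} = 2^a + 2^b`. -/
theorem val_pair {a b : ℤ} (h : a ≠ b) : val ({a, b} : Finset ℤ) = (2 : ℚ) ^ a + (2 : ℚ) ^ b := by
  unfold val; exact Finset.sum_pair h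

/-- Homogeneity (part 8j) for `treeBR`: shifting the configuration up by `k` multiplies by `2^k`. -/
theorem treeBR_image_add (t : SumTree) (S : Finset ℤ) (k : ℤ) :
    treeBR q t (S.image fun e => e + k) = (2 : ℚ) ^ k * treeBR q t S := by
  unfold treeBR; exact treeBRw_zpow_shift k t S

/-- The image of a two-bit configuration under a shift. -/
theorem image_pair_add (a b k : ℤ) :
    (({a, b} : Finset ℤ).image fun e => e + k) = ({a + k, b + k} : Finset ℤ) := by
  simp only [Finset.image_insert, Finset.image_singleton]

/-- **THE SINGLE-BIT `E`-ROWS AT `ρ = u`, EVERY LEVEL, EVERY TREE** (R31 + homogeneity + (M)): in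
the budget units of parts 8l/9d/10b, for every level `β = 2^k` (`k + 2 ≤ q`), every single-bit offset
`B = 2^i < β` and every tree, with `e = β + B`:
`2 BR_t(e) ≤ (1 - u) BR_t(e + β) + (1 + u) BR_t(e - β + ½)` — the `E`-row `E(β, B, ρ = u)` of
opt's split of the two-tree inequality (`eCheck` with `(ρn, ρd) = (1, 2^q)`) holds without any
certificate.  (`k = q - 2` is R31 itself; smaller `k` by scaling R31 down and raising
`BR_t(B + 2β u) ≤ BR_t(B + ½)` by (M).) -/
theorem treeBRv_eRow_singleBit (hq : 3 ≤ q) {k i : ℕ} (hk : k + 2 ≤ q) (hik : i < k) (t : SumTree) :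
    let β : ℚ := (2 : ℚ) ^ k
    let e : ℚ := β + ((2 ^ i : ℕ) : ℚ)
    2 * treeBRv q t e ≤ (1 - unitRoundoff q) * treeBRv q t (e + β) +
      (1 + unitRoundoff q) * treeBRv q t (e - β + 1 / 2) := by
  intro β e
  have hq1 : 1 ≤ q := by omega
  -- R31 at j = k + 1 - i, shifted up by k + 1
  obtain ⟨j, hj⟩ : ∃ j : ℕ, j = k + 1 - i := ⟨_, rfl⟩
  have hj2 : 2 ≤ j := by omega
  have hjq : j + 1 ≤ q := by omega
  have hjz : ((j : ℕ) : ℤ) = (k : ℤ) + 1 - i := by omega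
  have h := treeBR_twoFam_le hq hj2 hjq t
  have s1 := treeBR_image_add (q := q) t ({-1, -(j : ℤ)} : Finset ℤ) ((k : ℤ) + 1)
  have s2 := treeBR_image_add (q := q) t ({0, -(j : ℤ)} : Finset ℤ) ((k : ℤ) + 1)
  have s3 := treeBR_image_add (q := q) t ({-(j : ℤ), -(q : ℤ)} : Finset ℤ) ((k : ℤ) + 1)
  rw [image_pair_add] at s1 s2 s3
  have i1 : ({-1 + ((k : ℤ) + 1), -(j : ℤ) + ((k : ℤ) + 1)} : Finset ℤ) = {(k : ℤ), (i : ℤ)} := by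
    rw [hjz]; ext z; simp only [Finset.mem_insert, Finset.mem_singleton]; omega
  have i2 : ({0 + ((k : ℤ) + 1), -(j : ℤ) + ((k : ℤ) + 1)} : Finset ℤ) = {(k : ℤ) + 1, (i : ℤ)} := by
    rw [hjz]; ext z; simp only [Finset.mem_insert, Finset.mem_singleton]; omega
  have i3 : ({-(j : ℤ) + ((k : ℤ) + 1), -(q : ℤ) + ((k : ℤ) + 1)} : Finset ℤ) =
      {(i : ℤ), (k : ℤ) + 1 - q} := by
    rw [hjz]; ext z; simp only [Finset.mem_insert, Finset.mem_singleton]; omega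
  rw [i1] at s1
  rw [i2] at s2
  rw [i3] at s3
  -- (M): BR{i, k+1-q} ≤ BR{i, -1}
  have hM : treeBR q t {(i : ℤ), (k : ℤ) + 1 - q} ≤ treeBR q t {(i : ℤ), -1} := by
    refine treeBR_mono hq1 t (Finset.insert_nonempty _ _) (Finset.insert_nonempty _ _) ?_ ?_ ?_
    · intro a ha b hb
      simp only [Finset.mem_insert, Finset.mem_singleton] at ha hb
      rcases ha with rfl | rfl <;> rcases hb with rfl | rfl <;> omega
    · intro a ha b hb
      simp only [Finset.mem_insert, Finset.mem_singleton] at ha hb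
      rcases ha with rfl | rfl <;> rcases hb with rfl | rfl <;> omega
    · rw [val_pair (by omega), val_pair (by omega)]
      have : (2 : ℚ) ^ ((k : ℤ) + 1 - q) ≤ (2 : ℚ) ^ (-1 : ℤ) :=
        zpow_le_zpow_right₀ (by norm_num) (by omega)
      linarith
  -- the three values
  have hβ : β = (2 : ℚ) ^ (k : ℤ) := (zpow_natCast 2 k).symm
  have hB : ((2 ^ i : ℕ) : ℚ) = (2 : ℚ) ^ (i : ℤ) := by push_cast; exact (zpow_natCast 2 i).symm
  have he : e = val ({(k : ℤ), (i : ℤ)} : Finset ℤ) := by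
    rw [val_pair (by omega)]; show β + _ = _; rw [hβ, hB]
  have he1 : e + β = val ({(k : ℤ) + 1, (i : ℤ)} : Finset ℤ) := by
    rw [val_pair (by omega), he, val_pair (by omega), hβ, zpow_add_one₀ (by norm_num : (2 : ℚ) ≠ 0)]
    ring
  have he2 : e - β + 1 / 2 = val ({(i : ℤ), -1} : Finset ℤ) := by
    rw [val_pair (by omega), he, val_pair (by omega), hβ, zpow_neg_one]; ring
  rw [he1, he2, he, treeBRv_val, treeBRv_val, treeBRv_val, s1, s2]
  have hpos : 0 < (2 : ℚ) ^ ((k : ℤ) + 1) := zpow_pos (by norm_num) _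
  have hu1 : 0 ≤ 1 + unitRoundoff q := by linarith [unitRoundoff_nonneg q]
  have h' := mul_le_mul_of_nonneg_left h hpos.le
  have hM' := mul_le_mul_of_nonneg_left (mul_le_mul_of_nonneg_left hM hu1) hpos.le
  rw [s3] at hM'
  nlinarith [h', hM']

/-- **R31 BY VALUE** (the case `k = q - 2`, `β = 2^(q-2)` = opt's `β = ½`): for `q ≥ 3`, every
`i ≤ q - 3` and every tree, with `e = 2^(q-2) + 2^i`:
`2 BR_t(e) ≤ (1 - u) BR_t(e + 2^(q-2)) + (1 + u) BR_t(e - 2^(q-2) + ½)` — the `E`-row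
`E(β = ½, B = 2^-j, ρ = u)`, `j = q - 1 - i`, of opt gen 15 §5 for EVERY precision. -/
theorem treeBRv_eRow_halfBit (hq : 3 ≤ q) {i : ℕ} (hi : i + 3 ≤ q) (t : SumTree) :
    let β : ℚ := (2 : ℚ) ^ (q - 2)
    let e : ℚ := β + ((2 ^ i : ℕ) : ℚ)
    2 * treeBRv q t e ≤ (1 - unitRoundoff q) * treeBRv q t (e + β) +
      (1 + unitRoundoff q) * treeBRv q t (e - β + 1 / 2) :=
  treeBRv_eRow_singleBit hq (k := q - 2) (by omega) (by omega) t

end TwoFam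

end Summit.Ventures.CertifiedArithmetic.LowPrec.Opt
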